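import Mathlib.Analysis.SpecialFunctions.Integrals.Basic
import Mathlib.Analysis.SpecialFunctions.Integrability.Basic
import Mathlib.Analysis.SpecialFunctions.Pow.Continuity
import Mathlib.MeasureTheory.Integral.Bochner.Set
import Mathlib.MeasureTheory.Integral.IntervalIntegral.FundThmCalculus
import Mathlib.MeasureTheory.Function.L1Space.Integrable
import Literature.Analysis.FluidPDE.LerayVolterraComparison
import HarnessLib

/-!
# The nonlinear and the endpoint fractional Grönwall inequalities of Coiculescu–Palasek
  (App. B, Lemmas B.2–B.3)

Analysis/ODE support file (pure real analysis, everything proved) on the discharge path of the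
named fact `Literature.Barriers.NavierStokesRegularity.CoiculescuPalasek2025_perturbation`
(`CriticalDataSmoothNonuniquenessConstruction.lean`): the two Grönwall-type lemmas of
Appendix B of M. P. Coiculescu, S. Palasek, *Non-uniqueness of smooth solutions of the
Navier–Stokes equations from critical data*, Invent. Math. 244 (2025) (App. B = §7 of
arXiv:2503.14699v2), through which the proof of their Prop. 4.2 (bounds for the semigroup of the
linearisation around the principal part) controls `h(t) = t^{1/2}‖S(t,t')a‖_{L^∞}` from
`h(t) ≲ (t')^{-1+α}‖a‖_Y + ∫_{t'}^t (s^{-1/2} + (t-s)^{-1/2}) ‖v(s)‖_{L^∞} h(s) ds`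
"in a form where we can apply Lemma B.3 with `p = 3` (say), `g₁(s) = s^{-1/2}‖v(s)‖_{L^∞}` and
`g₂(s) = ‖v(s)‖_{L^∞}`".

* `nonlinear_gronwall_const` — Lemma B.2 with constant data (the case proved first in print):
  if `f, h₁, h₂ ≥ 0` are continuous on `[t₀, T]`, `a ≥ 0`, `p > 1`, and
  `f(t) ≤ a + ∫_{t₀}^t h₁ f + (∫_{t₀}^t h₂ f^p)^{1/p}` on `[t₀, T]`, then for every `C₆ > 0` with
  `C₆⁻¹ + (C₆ p)^{-1/p} < 1`, `f(t) ≤ C₆ a exp(C₆ ∫_{t₀}^t (h₁ + h₂))` on `[t₀, T]`. Proof as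
  printed: a continuity argument — at the first time `τ` where `f ≥ C₆ a E`,
  `E(t) = exp(C₆∫_{t₀}^t(h₁+h₂))`, inserting `f ≤ C₆ a E` on `[t₀, τ]` into the hypothesis and
  integrating
  `(h₁+h₂)E = (C₆)⁻¹ E'`, `(h₁+h₂)E^p = (pC₆)⁻¹ (E^p)'` gives
  `f(τ) ≤ C₆ a E(τ) (C₆⁻¹ + (C₆p)^{-1/p}) < C₆ a E(τ)` (for `a > 0`; `a = 0` by `a + δ`, `δ ↓ 0`).
* `nonlinear_gronwall` — Lemma B.2 as printed: non-decreasing `a, b₁, b₂ ≥ 0` and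
  `f(t) ≤ a(t) + b₁(t)∫_{t₀}^t h₁ f + (b₂(t)∫_{t₀}^t h₂ f^p)^{1/p}` give
  `f(t) ≤ C₆ a(t) exp(C₆ (b₁(t)∫_{t₀}^t h₁ + b₂(t)∫_{t₀}^t h₂))` (freeze the coefficients at `t`
  and apply the constant case on `[t₀, t]`). Continuity of `a, bᵢ` (assumed in print) is not
  needed.
* `setIntegral_sub_rpow_neg_mul_rpow_neg_le` — the Abel–Beta bound
  `∫_{(t₀,τ)} (τ-s)^{-α} s^{-β} ds ≤ (1/(1-α) + 1/(1-β)) (τ/2)^{1-α-β}` for `0 ≤ t₀ ≤ τ`, `0 < τ`,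
  `0 ≤ α, β < 1` (split at `τ/2`), with the integrability; for `α + β = 1` the bound is uniform
  in `τ` ("`∫_{t₀}^t (t-s)^{-α}s^{-β} ds ≤ π/sin πα`" in print — only finiteness is used).
* `fractional_gronwall` — Lemma B.3 (the endpoint fractional Grönwall inequality): for `p > 2`
  there is `C = C(p)` such that whenever `f, g₁, g₂ ≥ 0` are continuous on `[t₀, T]` (`t₀ ≥ 0`),
  `a ≥ 0` is non-decreasing, and `f(t) ≤ a(t) + ∫_{t₀}^t (g₁(s) + (t-s)^{-1/2} g₂(s)) f(s) ds` on
  `[t₀, T]`, then `f(t) ≤ C a(t) exp(C (∫_{t₀}^t g₁ + M^{p-2} ∫_{t₀}^t g₂²))` for every `t ∈ [t₀,T]`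
  and every bound `M ≥ sup_{[t₀,t]} s^{1/2} g₂(s)`. Proof as printed: Hölder with exponents
  `(p', p)` on `(t-s)^{-1/2} g₂^{1-2/p} · g₂^{2/p} f`, the bound `g₂ ≤ M s^{-1/2}` in the first
  factor, the Abel–Beta bound with `α = p'/2`, `β = (p-2)/(2(p-1))` (`α + β = 1`), then
  `nonlinear_gronwall_const` with `h₁ = g₁`, `h₂ = M^{p-2} B^{p-1} g₂²` and `C₆ = 4^p`.
* `fractional_gronwall_three` — the case `p = 3` in the shape used in the proof of Prop. 4.2.

Mathlib has the differential Grönwall inequality (`Mathlib.Analysis.ODE.Gronwall`) and Hölder's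
inequality (`MeasureTheory.integral_mul_le_Lp_mul_Lq_of_nonneg`) but no integral, nonlinear or
weakly-singular Grönwall lemma (`lean search 'fractional|nonlinear_gronwall|Volterra|Abel'`: only
the tree's `Literature.Analysis.FluidPDE.volterra_sqrt_comparison` and its Abel-kernel tools,
which are reused here).

## References

* M. P. Coiculescu, S. Palasek, *Non-uniqueness of smooth solutions of the Navier–Stokes equations
  from critical data*, Invent. Math. 244 (2025), 165–219, doi:10.1007/s00222-025-01396-z,
  arXiv:2503.14699: App. B (arXiv §7.2), Lemma B.2 (nonlinear Grönwall), Lemma B.3 (fractional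
  Grönwall), and the proof of Prop. 4.2 (their use with `p = 3`). [`CoiculescuPalasek2025`]
* D. Willett, *Nonlinear vector integral equations as contraction mappings*, Arch. Rational
  Mech. Anal. 15 (1964), 79–86 (cited in print for similar nonlinear inequalities).
-/

noncomputable section

open MeasureTheory Set Filter Topology intervalIntegral

namespace Literature.Analysis.ODE

open Literature.Analysis.FluidPDE

/-! ### Calculus of the Grönwall weight `exp (c ∫_{t₀}^{s} H)` -/

/-- For `H` continuous on `[t₀, τ]` and `c ≠ 0`,
`∫_{t₀}^{τ} H(s) exp(c ∫_{t₀}^{s} H) ds = (exp(c ∫_{t₀}^{τ} H) - 1)/c` (the fundamental theorem of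
calculus for `s ↦ exp(c∫_{t₀}^s H)/c`). [folklore] -/
theorem integral_mul_exp_mul_primitive {t₀ τ c : ℝ} {H : ℝ → ℝ} (hτ : t₀ ≤ τ)
    (hH : ContinuousOn H (Icc t₀ τ)) (hc : c ≠ 0) :
    ∫ s in t₀..τ, H s * Real.exp (c * ∫ u in t₀..s, H u) =
      (Real.exp (c * ∫ u in t₀..τ, H u) - 1) / c := by
  have hHu : ContinuousOn H (uIcc t₀ τ) := by rwa [uIcc_of_le hτ]
  have hHi : IntervalIntegrable H volume t₀ τ := hHu.intervalIntegrable
  -- the primitive and its continuity / derivative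
  have hΦc : ContinuousOn (fun s => ∫ u in t₀..s, H u) (Icc t₀ τ) := by
    have h := intervalIntegral.continuousOn_primitive_interval (μ := volume) (f := H)
      (a := t₀) (b := τ) (by rw [uIcc_of_le hτ]; exact hH.integrableOn_Icc)
    rwa [uIcc_of_le hτ] at h
  have hΦd : ∀ s ∈ Ioo t₀ τ, HasDerivAt (fun s => ∫ u in t₀..s, H u) (H s) s := by
    intro s hs
    refine intervalIntegral.integral_hasDerivAt_right (hHi.mono_set ?_) ?_ ?_
    · rw [uIcc_of_le hτ, uIcc_of_le hs.1.le]
      exact Icc_subset_Icc_right hs.2.le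
    · exact ContinuousOn.stronglyMeasurableAtFilter isOpen_Ioo (hH.mono Ioo_subset_Icc_self) s hs
    · exact hH.continuousAt (Icc_mem_nhds hs.1 hs.2)
  -- FTC for `F(s) = exp(c Φ s) / c`
  set F : ℝ → ℝ := fun s => Real.exp (c * ∫ u in t₀..s, H u) / c with hF
  have hFc : ContinuousOn F (Icc t₀ τ) :=
    ((Real.continuous_exp.comp_continuousOn (hΦc.const_smul c)).div_const c).congr
      (fun s _ => by simp [hF, smul_eq_mul])
  have hFd : ∀ s ∈ Ioo t₀ τ,
      HasDerivWithinAt F (H s * Real.exp (c * ∫ u in t₀..s, H u)) (Ioi s) s := by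
    intro s hs
    have h1 : HasDerivAt (fun s => c * ∫ u in t₀..s, H u) (c * H s) s := (hΦd s hs).const_mul c
    have h2 : HasDerivAt (fun s => Real.exp (c * ∫ u in t₀..s, H u))
        (Real.exp (c * ∫ u in t₀..s, H u) * (c * H s)) s := h1.exp
    have h3 := h2.div_const c
    have he : Real.exp (c * ∫ u in t₀..s, H u) * (c * H s) / c =
        H s * Real.exp (c * ∫ u in t₀..s, H u) := by
      field_simp
    rw [he] at h3
    exact h3.hasDerivWithinAt
  have hint : IntervalIntegrable (fun s => H s * Real.exp (c * ∫ u in t₀..s, H u)) volume t₀ τ := by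
    refine ContinuousOn.intervalIntegrable ?_
    rw [uIcc_of_le hτ]
    exact hH.mul (Real.continuous_exp.comp_continuousOn
      ((hΦc.const_smul c).congr (fun s _ => by simp [smul_eq_mul])))
  have h := intervalIntegral.integral_eq_sub_of_hasDeriv_right_of_le hτ hFc hFd hint
  rw [h, hF]
  simp only [intervalIntegral.integral_same, mul_zero, Real.exp_zero]
  ring

/-! ### Lemma B.2: the nonlinear Grönwall inequality -/

/-- **Lemma B.2 of Coiculescu–Palasek, constant data, `a > 0`** (the case treated first in the
printed proof, by a continuity argument). Let `p > 1`, `C₆ > 0` with `C₆⁻¹ + (C₆ p)^{-1/p} < 1`,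
`a > 0`, and let `f, h₁, h₂ ≥ 0` be continuous on `[t₀, T]` with
`f(t) ≤ a + ∫_{t₀}^t h₁ f + (∫_{t₀}^t h₂ f^p)^{1/p}` for `t ∈ [t₀, T]`. Then
`f(t) ≤ C₆ a exp(C₆ ∫_{t₀}^t (h₁ + h₂))` on `[t₀, T]`.
[cite: CoiculescuPalasek2025, App. B, Lemma B.2 (proof, constant case)] -/
theorem nonlinear_gronwall_const_pos {t₀ T p C₆ a : ℝ} {f h₁ h₂ : ℝ → ℝ}
    (hp : 1 < p) (hC₆ : 0 < C₆) (hC : C₆⁻¹ + (C₆ * p) ^ (-p⁻¹) < 1) (ha : 0 < a)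
    (hf : ContinuousOn f (Icc t₀ T)) (hh₁ : ContinuousOn h₁ (Icc t₀ T))
    (hh₂ : ContinuousOn h₂ (Icc t₀ T))
    (hf0 : ∀ t ∈ Icc t₀ T, 0 ≤ f t) (hh₁0 : ∀ t ∈ Icc t₀ T, 0 ≤ h₁ t)
    (hh₂0 : ∀ t ∈ Icc t₀ T, 0 ≤ h₂ t)
    (hineq : ∀ t ∈ Icc t₀ T,
      f t ≤ a + (∫ s in t₀..t, h₁ s * f s) + (∫ s in t₀..t, h₂ s * f s ^ p) ^ p⁻¹) :
    ∀ t ∈ Icc t₀ T, f t ≤ C₆ * a * Real.exp (C₆ * ∫ s in t₀..t, (h₁ s + h₂ s)) := by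
  have hp0 : 0 < p := one_pos.trans hp
  -- the comparison function `g = C₆ a E`, `E(t) = exp (C₆ ∫_{t₀}^t (h₁ + h₂))`
  set H : ℝ → ℝ := fun s => h₁ s + h₂ s with hHdef
  set E : ℝ → ℝ := fun t => Real.exp (C₆ * ∫ s in t₀..t, H s) with hEdef
  set g : ℝ → ℝ := fun t => C₆ * a * E t with hgdef
  have hHc : ContinuousOn H (Icc t₀ T) := hh₁.add hh₂
  have hH0 : ∀ t ∈ Icc t₀ T, 0 ≤ H t := fun t ht => add_nonneg (hh₁0 t ht) (hh₂0 t ht)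
  have hEpos : ∀ t, 0 < E t := fun t => Real.exp_pos _
  have hgpos : ∀ t, 0 < g t := fun t => mul_pos (mul_pos hC₆ ha) (hEpos t)
  -- continuity of `E`, `g` on `[t₀, T]`
  have hΦc : ContinuousOn (fun t => ∫ s in t₀..t, H s) (Icc t₀ T) := by
    rcases le_or_gt t₀ T with hT | hT
    · have h := intervalIntegral.continuousOn_primitive_interval (μ := volume) (f := H)
        (a := t₀) (b := T) (by rw [uIcc_of_le hT]; exact hHc.integrableOn_Icc)
      rwa [uIcc_of_le hT] at h
    · rw [Icc_eq_empty (not_le.2 hT)]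
      exact continuousOn_empty _
  have hEc : ContinuousOn E (Icc t₀ T) :=
    Real.continuous_exp.comp_continuousOn ((hΦc.const_smul C₆).congr
      (fun s _ => by simp [smul_eq_mul]))
  have hgc : ContinuousOn g (Icc t₀ T) := hEc.const_smul (C₆ * a) |>.congr
    (fun s _ => by simp [hgdef, smul_eq_mul])
  -- it suffices to rule out the bad set `{t ∈ [t₀,T] | g t ≤ f t}`
  suffices hlt : ∀ t ∈ Icc t₀ T, f t < g t from fun t ht => (hlt t ht).le
  by_contra hbad
  push Not at hbad
  set S : Set ℝ := Icc t₀ T ∩ (fun t => f t - g t) ⁻¹' (Ici 0) with hS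
  have hSc : IsClosed S := (hf.sub hgc).preimage_isClosed_of_isClosed isClosed_Icc isClosed_Ici
  have hSne : S.Nonempty := by
    obtain ⟨t, ht, hle⟩ := hbad
    exact ⟨t, ht, sub_nonneg.2 hle⟩
  have hSbdd : BddBelow S := ⟨t₀, fun t ht => ht.1.1⟩
  set τ : ℝ := sInf S with hτdef
  have hτS : τ ∈ S := hSc.csInf_mem hSne hSbdd
  have hτI : τ ∈ Icc t₀ T := hτS.1
  have hτle : g τ ≤ f τ := sub_nonneg.1 hτS.2
  -- below `τ` the strict comparison holds
  have hgood : ∀ s ∈ Ico t₀ τ, f s < g s := by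
    intro s hs
    by_contra hle
    have hsS : s ∈ S := ⟨⟨hs.1, hs.2.le.trans hτI.2⟩, sub_nonneg.2 (not_lt.1 hle)⟩
    exact absurd (csInf_le hSbdd hsS) (not_le.2 hs.2)
  have hgood' : ∀ s ∈ Ioo t₀ τ, f s ≤ g s := fun s hs => (hgood s ⟨hs.1.le, hs.2⟩).le
  -- restrictions to `[t₀, τ]`
  have hτ0 : t₀ ≤ τ := hτI.1
  have hsubI : Icc t₀ τ ⊆ Icc t₀ T := Icc_subset_Icc_right hτI.2
  have hfτ : ContinuousOn f (Icc t₀ τ) := hf.mono hsubI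
  have hh₁τ : ContinuousOn h₁ (Icc t₀ τ) := hh₁.mono hsubI
  have hh₂τ : ContinuousOn h₂ (Icc t₀ τ) := hh₂.mono hsubI
  have hHτ : ContinuousOn H (Icc t₀ τ) := hHc.mono hsubI
  have hEτ : ContinuousOn E (Icc t₀ τ) := hEc.mono hsubI
  have hgτ : ContinuousOn g (Icc t₀ τ) := hgc.mono hsubI
  have hfpτ : ContinuousOn (fun s => f s ^ p) (Icc t₀ τ) :=
    hfτ.rpow_const (fun s _ => Or.inr hp0.le)
  have hgpτ : ContinuousOn (fun s => g s ^ p) (Icc t₀ τ) :=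
    hgτ.rpow_const (fun s _ => Or.inr hp0.le)
  have hu : uIcc t₀ τ = Icc t₀ τ := uIcc_of_le hτ0
  have hII : ∀ {u : ℝ → ℝ}, ContinuousOn u (Icc t₀ τ) → IntervalIntegrable u volume t₀ τ :=
    fun hu' => ContinuousOn.intervalIntegrable (by rwa [hu])
  -- (i) the linear term: `∫ h₁ f ≤ ∫ H g = a (E τ - 1)`
  have hE1 : ∫ s in t₀..τ, H s * E s = (E τ - 1) / C₆ := by
    have h := integral_mul_exp_mul_primitive hτ0 hHτ hC₆.ne'
    simpa [hEdef] using h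
  have hlin : ∫ s in t₀..τ, h₁ s * f s ≤ a * (E τ - 1) := by
    calc ∫ s in t₀..τ, h₁ s * f s ≤ ∫ s in t₀..τ, h₁ s * g s := by
          refine intervalIntegral.integral_mono_on_of_le_Ioo hτ0 (hII (hh₁τ.mul hfτ))
            (hII (hh₁τ.mul hgτ)) fun s hs => ?_
          exact mul_le_mul_of_nonneg_left (hgood' s hs) (hh₁0 s (hsubI ⟨hs.1.le, hs.2.le⟩))
      _ ≤ ∫ s in t₀..τ, H s * g s := by
          refine intervalIntegral.integral_mono_on hτ0 (hII (hh₁τ.mul hgτ)) (hII (hHτ.mul hgτ))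
            fun s hs => ?_
          have : 0 ≤ h₂ s * g s := mul_nonneg (hh₂0 s (hsubI hs)) (hgpos s).le
          calc h₁ s * g s ≤ h₁ s * g s + h₂ s * g s := le_add_of_nonneg_right this
            _ = H s * g s := by simp only [hHdef]; ring
      _ = C₆ * a * ∫ s in t₀..τ, H s * E s := by
          rw [← intervalIntegral.integral_const_mul]
          congr 1
          ext s
          simp only [hgdef]
          ring
      _ = a * (E τ - 1) := by
          rw [hE1]
          field_simp
  -- (ii) the nonlinear term: `∫ h₂ f^p ≤ ∫ H g^p ≤ (C₆ a)^p (E τ)^p / (p C₆)`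
  have hEp : ∀ s, E s ^ p = Real.exp (p * C₆ * ∫ u in t₀..s, H u) := by
    intro s
    rw [hEdef, ← Real.exp_mul]
    ring_nf
  have hE2 : ∫ s in t₀..τ, H s * E s ^ p = (E τ ^ p - 1) / (p * C₆) := by
    have h := integral_mul_exp_mul_primitive hτ0 hHτ (mul_ne_zero hp0.ne' hC₆.ne')
    simp only [hEp]
    exact h
  have hnonlin : ∫ s in t₀..τ, h₂ s * f s ^ p ≤ (C₆ * a) ^ p * E τ ^ p / (p * C₆) := by
    calc ∫ s in t₀..τ, h₂ s * f s ^ p ≤ ∫ s in t₀..τ, h₂ s * g s ^ p := by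
          refine intervalIntegral.integral_mono_on_of_le_Ioo hτ0 (hII (hh₂τ.mul hfpτ))
            (hII (hh₂τ.mul hgpτ)) fun s hs => ?_
          have hsI : s ∈ Icc t₀ T := hsubI ⟨hs.1.le, hs.2.le⟩
          exact mul_le_mul_of_nonneg_left
            (Real.rpow_le_rpow (hf0 s hsI) (hgood' s hs) hp0.le) (hh₂0 s hsI)
      _ ≤ ∫ s in t₀..τ, H s * g s ^ p := by
          refine intervalIntegral.integral_mono_on hτ0 (hII (hh₂τ.mul hgpτ)) (hII (hHτ.mul hgpτ))
            fun s hs => ?_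
          have : 0 ≤ h₁ s * g s ^ p :=
            mul_nonneg (hh₁0 s (hsubI hs)) (Real.rpow_nonneg (hgpos s).le _)
          calc h₂ s * g s ^ p ≤ h₁ s * g s ^ p + h₂ s * g s ^ p := le_add_of_nonneg_left this
            _ = H s * g s ^ p := by simp only [hHdef]; ring
      _ = (C₆ * a) ^ p * ∫ s in t₀..τ, H s * E s ^ p := by
          rw [← intervalIntegral.integral_const_mul]
          congr 1
          ext s
          simp only [hgdef]
          rw [Real.mul_rpow (mul_pos hC₆ ha).le (hEpos s).le]
          ring
      _ = (C₆ * a) ^ p * ((E τ ^ p - 1) / (p * C₆)) := by rw [hE2]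
      _ ≤ (C₆ * a) ^ p * (E τ ^ p / (p * C₆)) := by
          gcongr
          linarith
      _ = (C₆ * a) ^ p * E τ ^ p / (p * C₆) := by ring
  have hroot : (∫ s in t₀..τ, h₂ s * f s ^ p) ^ p⁻¹ ≤ C₆ * a * E τ * (C₆ * p) ^ (-p⁻¹) := by
    have hI0 : 0 ≤ ∫ s in t₀..τ, h₂ s * f s ^ p :=
      intervalIntegral.integral_nonneg hτ0 fun s hs =>
        mul_nonneg (hh₂0 s (hsubI hs)) (Real.rpow_nonneg (hf0 s (hsubI hs)) _)
    calc (∫ s in t₀..τ, h₂ s * f s ^ p) ^ p⁻¹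
        ≤ ((C₆ * a) ^ p * E τ ^ p / (p * C₆)) ^ p⁻¹ :=
          Real.rpow_le_rpow hI0 hnonlin (inv_nonneg.2 hp0.le)
      _ = C₆ * a * E τ * (C₆ * p) ^ (-p⁻¹) := by
          rw [div_eq_mul_inv, ← Real.mul_rpow (mul_pos hC₆ ha).le (hEpos τ).le,
            Real.mul_rpow (Real.rpow_nonneg (mul_pos (mul_pos hC₆ ha) (hEpos τ)).le _)
              (inv_nonneg.2 (mul_pos hp0 hC₆).le),
            Real.rpow_rpow_inv (mul_pos (mul_pos hC₆ ha) (hEpos τ)).le hp0.ne',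
            Real.inv_rpow (mul_pos hp0 hC₆).le, ← Real.rpow_neg (mul_pos hp0 hC₆).le,
            mul_comm p C₆]
  -- (iii) the contradiction at `τ`
  have hkey : f τ < g τ := by
    have hθ : 0 < 1 - (C₆⁻¹ + (C₆ * p) ^ (-p⁻¹)) := sub_pos.2 hC
    calc f τ ≤ a + (∫ s in t₀..τ, h₁ s * f s) + (∫ s in t₀..τ, h₂ s * f s ^ p) ^ p⁻¹ :=
          hineq τ hτI
      _ ≤ a + a * (E τ - 1) + C₆ * a * E τ * (C₆ * p) ^ (-p⁻¹) := by gcongr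
      _ = g τ * (C₆⁻¹ + (C₆ * p) ^ (-p⁻¹)) := by
          simp only [hgdef]
          field_simp
          ring
      _ < g τ := by
          have hg := hgpos τ
          nlinarith [mul_pos hg hθ]
  exact absurd hτle (not_le.2 hkey)

/-- **Lemma B.2 of Coiculescu–Palasek, constant data.** As `nonlinear_gronwall_const_pos` with
`a ≥ 0` (apply it with `a + δ` and let `δ ↓ 0`).
[cite: CoiculescuPalasek2025, App. B, Lemma B.2 (proof, constant case)] -/
theorem nonlinear_gronwall_const {t₀ T p C₆ a : ℝ} {f h₁ h₂ : ℝ → ℝ}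
    (hp : 1 < p) (hC₆ : 0 < C₆) (hC : C₆⁻¹ + (C₆ * p) ^ (-p⁻¹) < 1) (ha : 0 ≤ a)
    (hf : ContinuousOn f (Icc t₀ T)) (hh₁ : ContinuousOn h₁ (Icc t₀ T))
    (hh₂ : ContinuousOn h₂ (Icc t₀ T))
    (hf0 : ∀ t ∈ Icc t₀ T, 0 ≤ f t) (hh₁0 : ∀ t ∈ Icc t₀ T, 0 ≤ h₁ t)
    (hh₂0 : ∀ t ∈ Icc t₀ T, 0 ≤ h₂ t)
    (hineq : ∀ t ∈ Icc t₀ T,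
      f t ≤ a + (∫ s in t₀..t, h₁ s * f s) + (∫ s in t₀..t, h₂ s * f s ^ p) ^ p⁻¹) :
    ∀ t ∈ Icc t₀ T, f t ≤ C₆ * a * Real.exp (C₆ * ∫ s in t₀..t, (h₁ s + h₂ s)) := by
  intro t ht
  have key : ∀ δ : ℝ, 0 < δ →
      f t ≤ C₆ * (a + δ) * Real.exp (C₆ * ∫ s in t₀..t, (h₁ s + h₂ s)) := by
    intro δ hδ
    refine nonlinear_gronwall_const_pos hp hC₆ hC (add_pos_of_nonneg_of_pos ha hδ) hf hh₁ hh₂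
      hf0 hh₁0 hh₂0 (fun t ht => ?_) t ht
    have h := hineq t ht
    linarith
  set X : ℝ := Real.exp (C₆ * ∫ s in t₀..t, (h₁ s + h₂ s)) with hX
  have hXpos : 0 < X := Real.exp_pos _
  refine le_of_forall_pos_lt_add fun ε hε => ?_
  have hδ : 0 < ε / (2 * C₆ * X) := by positivity
  have h := key _ hδ
  have he : C₆ * (a + ε / (2 * C₆ * X)) * X = C₆ * a * X + ε / 2 := by
    field_simp
  rw [he] at h
  linarith

/-- **Lemma B.2 of Coiculescu–Palasek (nonlinear Grönwall inequality), as printed.** Let `f`,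
`h₁`, `h₂` be non-negative continuous functions on `[t₀, T]` and `a`, `b₁`, `b₂` non-negative and
non-decreasing there. Suppose that for some `p > 1`,
`f(t) ≤ a(t) + b₁(t) ∫_{t₀}^t h₁(s) f(s) ds + (b₂(t) ∫_{t₀}^t h₂(s) f(s)^p ds)^{1/p}`. Then for any
constant `C₆ > 0` with `C₆⁻¹ + (C₆ p)^{-1/p} < 1`,
`f(t) ≤ C₆ a(t) exp(C₆ (b₁(t) ∫_{t₀}^t h₁(s) ds + b₂(t) ∫_{t₀}^t h₂(s) ds))`. (Printed on `[t₀, ∞)`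
with `a, bᵢ` continuous; here on a compact interval, and the continuity of `a, bᵢ` is not used:
fix `t`, freeze the coefficients at `t` by monotonicity and apply the constant case on `[t₀, t]`,
exactly as in the printed reduction.) [cite: CoiculescuPalasek2025, App. B, Lemma B.2] -/
theorem nonlinear_gronwall {t₀ T p C₆ : ℝ} {f a b₁ b₂ h₁ h₂ : ℝ → ℝ}
    (hp : 1 < p) (hC₆ : 0 < C₆) (hC : C₆⁻¹ + (C₆ * p) ^ (-p⁻¹) < 1)
    (hf : ContinuousOn f (Icc t₀ T)) (hh₁ : ContinuousOn h₁ (Icc t₀ T))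
    (hh₂ : ContinuousOn h₂ (Icc t₀ T))
    (hf0 : ∀ t ∈ Icc t₀ T, 0 ≤ f t) (hh₁0 : ∀ t ∈ Icc t₀ T, 0 ≤ h₁ t)
    (hh₂0 : ∀ t ∈ Icc t₀ T, 0 ≤ h₂ t) (ha0 : ∀ t ∈ Icc t₀ T, 0 ≤ a t)
    (hb₁0 : ∀ t ∈ Icc t₀ T, 0 ≤ b₁ t) (hb₂0 : ∀ t ∈ Icc t₀ T, 0 ≤ b₂ t)
    (ha : MonotoneOn a (Icc t₀ T)) (hb₁ : MonotoneOn b₁ (Icc t₀ T))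
    (hb₂ : MonotoneOn b₂ (Icc t₀ T))
    (hineq : ∀ t ∈ Icc t₀ T,
      f t ≤ a t + b₁ t * (∫ s in t₀..t, h₁ s * f s) +
        (b₂ t * ∫ s in t₀..t, h₂ s * f s ^ p) ^ p⁻¹) :
    ∀ t ∈ Icc t₀ T, f t ≤ C₆ * a t *
      Real.exp (C₆ * (b₁ t * (∫ s in t₀..t, h₁ s) + b₂ t * ∫ s in t₀..t, h₂ s)) := by
  intro t ht
  have hp0 : 0 < p := one_pos.trans hp
  have hsub : Icc t₀ t ⊆ Icc t₀ T := Icc_subset_Icc_right ht.2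
  -- the frozen coefficients
  have hB₁ := hb₁0 t ht
  have hB₂ := hb₂0 t ht
  have hft : ContinuousOn f (Icc t₀ t) := hf.mono hsub
  have hh₁t : ContinuousOn (fun s => b₁ t * h₁ s) (Icc t₀ t) := (hh₁.mono hsub).const_smul (b₁ t)
  have hh₂t : ContinuousOn (fun s => b₂ t * h₂ s) (Icc t₀ t) := (hh₂.mono hsub).const_smul (b₂ t)
  have key := nonlinear_gronwall_const (t₀ := t₀) (T := t) (a := a t) (f := f)
    (h₁ := fun s => b₁ t * h₁ s) (h₂ := fun s => b₂ t * h₂ s) hp hC₆ hC (ha0 t ht) hft hh₁t hh₂t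
    (fun s hs => hf0 s (hsub hs)) (fun s hs => mul_nonneg hB₁ (hh₁0 s (hsub hs)))
    (fun s hs => mul_nonneg hB₂ (hh₂0 s (hsub hs))) ?_ t ⟨ht.1, le_rfl⟩
  · -- unfreeze: `∫ (b₁ h₁ + b₂ h₂) = b₁ ∫ h₁ + b₂ ∫ h₂`
    have hu : uIcc t₀ t = Icc t₀ t := uIcc_of_le ht.1
    have hi₁ : IntervalIntegrable h₁ volume t₀ t :=
      ContinuousOn.intervalIntegrable (by rw [hu]; exact hh₁.mono hsub)
    have hi₂ : IntervalIntegrable h₂ volume t₀ t :=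
      ContinuousOn.intervalIntegrable (by rw [hu]; exact hh₂.mono hsub)
    have he : ∫ s in t₀..t, (b₁ t * h₁ s + b₂ t * h₂ s) =
        b₁ t * (∫ s in t₀..t, h₁ s) + b₂ t * ∫ s in t₀..t, h₂ s := by
      rw [intervalIntegral.integral_add (hi₁.const_mul _) (hi₂.const_mul _),
        intervalIntegral.integral_const_mul, intervalIntegral.integral_const_mul]
    rw [he] at key
    exact key
  · -- the frozen hypothesis on `[t₀, t]`
    intro τ hτ
    have hτT : τ ∈ Icc t₀ T := hsub hτ
    have hsubτ : Icc t₀ τ ⊆ Icc t₀ T := Icc_subset_Icc_right hτT.2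
    have hI₁ : 0 ≤ ∫ s in t₀..τ, h₁ s * f s :=
      intervalIntegral.integral_nonneg hτ.1 fun s hs =>
        mul_nonneg (hh₁0 s (hsubτ hs)) (hf0 s (hsubτ hs))
    have hI₂ : 0 ≤ ∫ s in t₀..τ, h₂ s * f s ^ p :=
      intervalIntegral.integral_nonneg hτ.1 fun s hs =>
        mul_nonneg (hh₂0 s (hsubτ hs)) (Real.rpow_nonneg (hf0 s (hsubτ hs)) _)
    have haτ : a τ ≤ a t := ha hτT ht hτ.2
    have hb₁τ : b₁ τ ≤ b₁ t := hb₁ hτT ht hτ.2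
    have hb₂τ : b₂ τ ≤ b₂ t := hb₂ hτT ht hτ.2
    have he₁ : ∫ s in t₀..τ, b₁ t * h₁ s * f s = b₁ t * ∫ s in t₀..τ, h₁ s * f s := by
      rw [← intervalIntegral.integral_const_mul]
      congr 1
      ext s
      ring
    have he₂ : ∫ s in t₀..τ, b₂ t * h₂ s * f s ^ p = b₂ t * ∫ s in t₀..τ, h₂ s * f s ^ p := by
      rw [← intervalIntegral.integral_const_mul]
      congr 1
      ext s
      ring
    rw [he₁, he₂]
    calc f τ ≤ a τ + b₁ τ * (∫ s in t₀..τ, h₁ s * f s) +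
          (b₂ τ * ∫ s in t₀..τ, h₂ s * f s ^ p) ^ p⁻¹ := hineq τ hτT
      _ ≤ a t + b₁ t * (∫ s in t₀..τ, h₁ s * f s) +
          (b₂ t * ∫ s in t₀..τ, h₂ s * f s ^ p) ^ p⁻¹ := by
          gcongr
          · exact mul_nonneg (hb₂0 τ hτT) hI₂

/-! ### The Abel–Beta bound with general exponents -/

/-- `∫_{(a,τ)} (τ - s)^{-α} ds = (τ - a)^{1-α}/(1-α)` for `a ≤ τ`, `α < 1`. [folklore] -/
theorem setIntegral_Ioo_sub_rpow_neg {a τ α : ℝ} (haτ : a ≤ τ) (hα : α < 1) :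
    ∫ s in Ioo a τ, (τ - s) ^ (-α) = (τ - a) ^ (1 - α) / (1 - α) := by
  rw [← integral_Ioc_eq_integral_Ioo, ← intervalIntegral.integral_of_le haτ,
    intervalIntegral.integral_comp_sub_left (fun s : ℝ => s ^ (-α)) τ, sub_self,
    integral_rpow (Or.inl (by linarith))]
  have h1 : -α + 1 = 1 - α := by ring
  rw [h1, Real.zero_rpow (by linarith), sub_zero]

/-- **The Abel–Beta bound with general exponents.** For `0 ≤ α < 1`, `0 ≤ β < 1`, `0 ≤ t₀` and
`0 < τ`: the function `s ↦ (τ - s)^{-α} s^{-β}` is integrable on `(t₀, τ)` and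
`∫_{(t₀,τ)} (τ - s)^{-α} s^{-β} ds ≤ (1/(1-α) + 1/(1-β)) (τ/2)^{1-α-β}` (split `(0, τ)` at `τ/2`:
on `(0, τ/2]` the kernel is at most `(τ/2)^{-α}`, on `(τ/2, τ)` the weight is at most
`(τ/2)^{-β}`). When `α + β = 1` the bound does not depend on `τ`; the exact value for `t₀ = 0`
is `B(1-α, 1-β) τ^{1-α-β}` ("`≤ π/sin πα`" for `α + β = 1` in print; only finiteness is used).
[cite: CoiculescuPalasek2025, App. B, proof of Lemma B.3] -/
theorem setIntegral_sub_rpow_neg_mul_rpow_neg_le {α β t₀ τ : ℝ} (hα0 : 0 ≤ α) (hα : α < 1)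
    (hβ0 : 0 ≤ β) (hβ : β < 1) (ht₀ : 0 ≤ t₀) (hτ : 0 < τ) :
    IntegrableOn (fun s : ℝ => (τ - s) ^ (-α) * s ^ (-β)) (Ioo t₀ τ) ∧
      ∫ s in Ioo t₀ τ, (τ - s) ^ (-α) * s ^ (-β) ≤
        (1 / (1 - α) + 1 / (1 - β)) * (τ / 2) ^ (1 - α - β) := by
  have hτ2 : 0 < τ / 2 := by positivity
  have h1α : 0 < 1 - α := by linarith
  have h1β : 0 < 1 - β := by linarith
  set I₁ : Set ℝ := Ioc 0 (τ / 2) with hI₁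
  set I₂ : Set ℝ := Ioo (τ / 2) τ with hI₂
  have hunion : I₁ ∪ I₂ = Ioo 0 τ := Ioc_union_Ioo_eq_Ioo hτ2.le (by linarith)
  have hdisj : Disjoint I₁ I₂ := by
    rw [hI₁, hI₂, Set.disjoint_left]
    intro s hs hs'
    exact absurd hs'.1 (not_lt.2 hs.2)
  set F : ℝ → ℝ := fun s => (τ - s) ^ (-α) * s ^ (-β) with hF
  have hmk : Measurable fun s : ℝ => (τ - s) ^ (-α) := measurable_sub_rpow_const τ _
  have hmw : Measurable fun s : ℝ => s ^ (-β) := measurable_id.pow_const _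
  have hF0 : ∀ s ∈ Ioo 0 τ, 0 ≤ F s := fun s hs =>
    mul_nonneg (Real.rpow_nonneg (by linarith [hs.2]) _) (Real.rpow_nonneg hs.1.le _)
  -- piece 1: kernel bounded by `(τ/2)^{-α}`, weight integrable
  have hk1 : ∀ s ∈ I₁, (τ - s) ^ (-α) ≤ (τ / 2) ^ (-α) := fun s hs =>
    Real.rpow_le_rpow_of_nonpos hτ2 (by linarith [hs.2]) (by linarith)
  have hk1' : ∀ s ∈ I₁, 0 ≤ (τ - s) ^ (-α) := fun s hs =>
    Real.rpow_nonneg (by linarith [hs.2]) _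
  have hw1 : IntegrableOn (fun s : ℝ => s ^ (-β)) I₁ := by
    have h := intervalIntegral.intervalIntegrable_rpow' (show -1 < -β by linarith)
      (a := 0) (b := τ / 2)
    rwa [intervalIntegrable_iff_integrableOn_Ioc_of_le hτ2.le] at h
  have hint1 : IntegrableOn F I₁ := by
    refine Integrable.bdd_mul (c := (τ / 2) ^ (-α)) hw1 hmk.aestronglyMeasurable ?_
    refine (ae_restrict_iff' measurableSet_Ioc).2 (Eventually.of_forall fun s hs => ?_)
    rw [Real.norm_of_nonneg (hk1' s hs)]
    exact hk1 s hs
  -- piece 2: weight bounded by `(τ/2)^{-β}`, kernel integrable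
  have hw2 : ∀ s ∈ I₂, s ^ (-β) ≤ (τ / 2) ^ (-β) := fun s hs =>
    Real.rpow_le_rpow_of_nonpos hτ2 hs.1.le (by linarith)
  have hw2' : ∀ s ∈ I₂, 0 ≤ s ^ (-β) := fun s hs => Real.rpow_nonneg (hτ2.trans hs.1).le _
  have hk2 : IntegrableOn (fun s : ℝ => (τ - s) ^ (-α)) I₂ :=
    integrableOn_sub_rpow_Ioo (by linarith)
  have hint2 : IntegrableOn F I₂ := by
    refine Integrable.mul_bdd (c := (τ / 2) ^ (-β)) hk2 hmw.aestronglyMeasurable ?_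
    refine (ae_restrict_iff' measurableSet_Ioo).2 (Eventually.of_forall fun s hs => ?_)
    rw [Real.norm_of_nonneg (hw2' s hs)]
    exact hw2 s hs
  have hint : IntegrableOn F (Ioo 0 τ) := by
    rw [← hunion]
    exact hint1.union hint2
  have hsubI : Ioo t₀ τ ⊆ Ioo 0 τ := Ioo_subset_Ioo_left ht₀
  refine ⟨hint.mono_set hsubI, ?_⟩
  -- the estimate on `(0, τ)`
  have hsplit : ∫ s in Ioo 0 τ, F s = (∫ s in I₁, F s) + ∫ s in I₂, F s := by
    rw [← hunion]
    exact setIntegral_union hdisj measurableSet_Ioo hint1 hint2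
  have hb1 : ∫ s in I₁, F s ≤ (τ / 2) ^ (-α) * ((τ / 2) ^ (1 - β) / (1 - β)) := by
    calc ∫ s in I₁, F s ≤ ∫ s in I₁, (τ / 2) ^ (-α) * s ^ (-β) := by
          refine setIntegral_mono_on hint1 (hw1.const_mul _) measurableSet_Ioc fun s hs => ?_
          exact mul_le_mul_of_nonneg_right (hk1 s hs) (Real.rpow_nonneg hs.1.le _)
      _ = (τ / 2) ^ (-α) * ((τ / 2) ^ (1 - β) / (1 - β)) := by
          rw [MeasureTheory.integral_const_mul, hI₁, integral_Ioc_eq_integral_Ioo,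
            setIntegral_Ioo_rpow_neg hτ2.le hβ]
  have hb2 : ∫ s in I₂, F s ≤ (τ / 2) ^ (-β) * ((τ - τ / 2) ^ (1 - α) / (1 - α)) := by
    calc ∫ s in I₂, F s ≤ ∫ s in I₂, (τ / 2) ^ (-β) * (τ - s) ^ (-α) := by
          refine setIntegral_mono_on hint2 (hk2.const_mul _) measurableSet_Ioo fun s hs => ?_
          rw [hF]
          dsimp only
          rw [mul_comm]
          exact mul_le_mul_of_nonneg_right (hw2 s hs) (Real.rpow_nonneg (by linarith [hs.2]) _)
      _ = (τ / 2) ^ (-β) * ((τ - τ / 2) ^ (1 - α) / (1 - α)) := by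
          rw [MeasureTheory.integral_const_mul, hI₂, setIntegral_Ioo_sub_rpow_neg (by linarith) hα]
  have e1 : (τ / 2) ^ (-α) * ((τ / 2) ^ (1 - β) / (1 - β)) =
      (1 / (1 - β)) * (τ / 2) ^ (1 - α - β) := by
    rw [mul_div_assoc', ← Real.rpow_add hτ2]
    have : -α + (1 - β) = 1 - α - β := by ring
    rw [this]
    ring
  have e2 : (τ / 2) ^ (-β) * ((τ - τ / 2) ^ (1 - α) / (1 - α)) =
      (1 / (1 - α)) * (τ / 2) ^ (1 - α - β) := by
    have : τ - τ / 2 = τ / 2 := by ring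
    rw [this, mul_div_assoc', ← Real.rpow_add hτ2]
    have : -β + (1 - α) = 1 - α - β := by ring
    rw [this]
    ring
  calc ∫ s in Ioo t₀ τ, F s ≤ ∫ s in Ioo 0 τ, F s :=
        setIntegral_mono_set hint ((ae_restrict_iff' measurableSet_Ioo).2
          (Eventually.of_forall hF0)) (Eventually.of_forall hsubI)
    _ = (∫ s in I₁, F s) + ∫ s in I₂, F s := hsplit
    _ ≤ (1 / (1 - β)) * (τ / 2) ^ (1 - α - β) + (1 / (1 - α)) * (τ / 2) ^ (1 - α - β) := by
        rw [← e1, ← e2]; exact add_le_add hb1 hb2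
    _ = (1 / (1 - α) + 1 / (1 - β)) * (τ / 2) ^ (1 - α - β) := by ring

/-! ### Lemma B.3: the endpoint fractional Grönwall inequality -/

/-- **The Hölder step in the proof of Lemma B.3.** For `p > 2`, `0 ≤ t₀ < τ`, `f, g₂ ≥ 0`
continuous on `[t₀, τ]` with `s^{1/2} g₂(s) ≤ M` there, and any bound `B` for the Abel–Beta
integral `∫_{(t₀,τ)} (τ-s)^{-α} s^{-β} ds` with `α = p'/2 = p/(2(p-1))`, `β = (p-2)/(2(p-1))`:
`∫_{t₀}^{τ} (τ-s)^{-1/2} g₂ f ds ≤ M^{1-2/p} B^{1/p'} (∫_{t₀}^{τ} g₂² f^p ds)^{1/p}`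
(`1/p' = 1 - 1/p`). In print: "By Hölder's inequality,
`∫ (t-s)^{-1/2} g₂ f ≤ (∫ (t-s)^{-p'/2} g₂^{(1-2/p)p'})^{1/p'} (∫ g₂² f^p)^{1/p}`. The first
factor on the right-hand side is controlled by
`‖s^{1/2}g₂‖_{L^∞}^{1-2/p} (∫ (t-s)^{-α}s^{-β} ds)^{1-1/p}`."
[cite: CoiculescuPalasek2025, App. B, Lemma B.3 (proof)] -/
theorem integral_abel_mul_le_of_sqrt_mul_le {p B t₀ τ M : ℝ} {f g₂ : ℝ → ℝ} (hp : 2 < p)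
    (ht₀ : 0 ≤ t₀) (hτ : t₀ < τ)
    (hf : ContinuousOn f (Icc t₀ τ)) (hg₂ : ContinuousOn g₂ (Icc t₀ τ))
    (hf0 : ∀ s ∈ Icc t₀ τ, 0 ≤ f s) (hg₂0 : ∀ s ∈ Icc t₀ τ, 0 ≤ g₂ s)
    (hM : ∀ s ∈ Icc t₀ τ, Real.sqrt s * g₂ s ≤ M)
    (hBi : IntegrableOn (fun s : ℝ =>
      (τ - s) ^ (-(p / (2 * (p - 1)))) * s ^ (-((p - 2) / (2 * (p - 1))))) (Ioo t₀ τ))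
    (hB : ∫ s in Ioo t₀ τ,
      (τ - s) ^ (-(p / (2 * (p - 1)))) * s ^ (-((p - 2) / (2 * (p - 1)))) ≤ B) :
    ∫ s in t₀..τ, (τ - s) ^ (-(1 / 2 : ℝ)) * g₂ s * f s ≤
      M ^ (1 - 2 / p) * B ^ (1 - 1 / p) * (∫ s in t₀..τ, g₂ s ^ 2 * f s ^ p) ^ (1 / p) := by
  -- exponents
  have hp0 : 0 < p := by linarith
  have hp1 : 1 < p := by linarith
  have hp1' : (0 : ℝ) < p - 1 := by linarith
  set p' : ℝ := p / (p - 1) with hp'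
  have hpp' : p'.HolderConjugate p := (Real.HolderConjugate.conjExponent hp1).symm
  have hp'0 : 0 < p' := hpp'.pos
  set α : ℝ := p / (2 * (p - 1)) with hα
  set β : ℝ := (p - 2) / (2 * (p - 1)) with hβ
  set γ : ℝ := 1 / 2 - 1 / p with hγ
  have hγ0 : 0 ≤ γ := by
    rw [hγ, sub_nonneg]
    exact one_div_le_one_div_of_le two_pos hp.le
  have hγ1 : γ < 1 := by
    rw [hγ]
    have : 0 < 1 / p := by positivity
    linarith
  have h12p : 0 < 1 - 2 / p := by
    rw [sub_pos, div_lt_one hp0]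
    exact hp
  have hαp' : -(1 / 2 : ℝ) * p' = -α := by
    rw [hp', hα]
    field_simp
  have hγp' : -γ * p' = -β := by
    rw [hγ, hp', hβ]
    field_simp
  have h1p' : 1 / p' = 1 - 1 / p := by
    rw [hp']
    field_simp
  have hτ0 : 0 < τ := lt_of_le_of_lt ht₀ hτ
  -- `M ≥ 0`
  have ht₀I : t₀ ∈ Icc t₀ τ := left_mem_Icc.2 hτ.le
  have hM0 : 0 ≤ M :=
    (mul_nonneg (Real.sqrt_nonneg _) (hg₂0 t₀ ht₀I)).trans (hM t₀ ht₀I)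
  -- the weight `w ∈ L^{p'}` and the bounded factor `G`
  set w : ℝ → ℝ := fun s => (τ - s) ^ (-(1 / 2 : ℝ)) * s ^ (-γ) with hw
  set G : ℝ → ℝ := fun s => g₂ s ^ (2 / p) * f s with hG
  have hw0 : ∀ s ∈ Ioo t₀ τ, 0 ≤ w s := fun s hs =>
    mul_nonneg (Real.rpow_nonneg (by linarith [hs.2]) _) (Real.rpow_nonneg (ht₀.trans hs.1.le) _)
  have hG0 : ∀ s ∈ Icc t₀ τ, 0 ≤ G s := fun s hs =>
    mul_nonneg (Real.rpow_nonneg (hg₂0 s hs) _) (hf0 s hs)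
  have hGc : ContinuousOn G (Icc t₀ τ) :=
    (hg₂.rpow_const fun s _ => Or.inr (by positivity)).mul hf
  have hwm : Measurable w := (measurable_sub_rpow_const τ _).mul (measurable_id.pow_const _)
  -- pointwise bound on `(t₀, τ)`
  have hpt : ∀ s ∈ Ioo t₀ τ,
      (τ - s) ^ (-(1 / 2 : ℝ)) * g₂ s * f s ≤ M ^ (1 - 2 / p) * (w s * G s) := by
    intro s hs
    have hs0 : 0 < s := lt_of_le_of_lt ht₀ hs.1
    have hsI : s ∈ Icc t₀ τ := ⟨hs.1.le, hs.2.le⟩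
    have hg := hg₂0 s hsI
    have h1 : g₂ s ≤ M * s ^ (-(1 / 2 : ℝ)) := by
      have hsq : 0 < Real.sqrt s := Real.sqrt_pos.2 hs0
      have hMs := hM s hsI
      rw [Real.rpow_neg hs0.le, ← Real.sqrt_eq_rpow, ← div_eq_mul_inv, le_div_iff₀ hsq]
      linarith [mul_comm (Real.sqrt s) (g₂ s)]
    have h2 : g₂ s ^ (1 - 2 / p) ≤ M ^ (1 - 2 / p) * s ^ (-γ) := by
      calc g₂ s ^ (1 - 2 / p) ≤ (M * s ^ (-(1 / 2 : ℝ))) ^ (1 - 2 / p) :=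
            Real.rpow_le_rpow hg h1 h12p.le
        _ = M ^ (1 - 2 / p) * s ^ (-γ) := by
            rw [Real.mul_rpow hM0 (Real.rpow_nonneg hs0.le _), ← Real.rpow_mul hs0.le]
            congr 2
            rw [hγ]
            ring
    have h3 : g₂ s = g₂ s ^ (1 - 2 / p) * g₂ s ^ (2 / p) := by
      have he : (1 - 2 / p) + 2 / p = 1 := by ring
      rw [← Real.rpow_add' hg (by rw [he]; exact one_ne_zero), he, Real.rpow_one]
    calc (τ - s) ^ (-(1 / 2 : ℝ)) * g₂ s * f s
        = (τ - s) ^ (-(1 / 2 : ℝ)) * g₂ s ^ (1 - 2 / p) * (g₂ s ^ (2 / p) * f s) := by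
          conv_lhs => rw [h3]
          ring
      _ ≤ (τ - s) ^ (-(1 / 2 : ℝ)) * (M ^ (1 - 2 / p) * s ^ (-γ)) * (g₂ s ^ (2 / p) * f s) := by
          apply mul_le_mul_of_nonneg_right
          · exact mul_le_mul_of_nonneg_left h2 (Real.rpow_nonneg (by linarith [hs.2]) _)
          · exact mul_nonneg (Real.rpow_nonneg hg _) (hf0 s hsI)
      _ = M ^ (1 - 2 / p) * (w s * G s) := by
          simp only [hw, hG]
          ring
  -- `w ^ p' = (τ - s)^{-α} s^{-β}` on `(t₀, τ)`
  have hwp' : ∀ s ∈ Ioo t₀ τ, w s ^ p' = (τ - s) ^ (-α) * s ^ (-β) := by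
    intro s hs
    have hs0 : 0 ≤ s := ht₀.trans hs.1.le
    have hτs : 0 ≤ τ - s := by linarith [hs.2]
    simp only [hw]
    rw [Real.mul_rpow (Real.rpow_nonneg hτs _) (Real.rpow_nonneg hs0 _),
      ← Real.rpow_mul hτs, ← Real.rpow_mul hs0, hαp', hγp']
  -- integrability
  obtain ⟨CG, hCG⟩ := isCompact_Icc.exists_bound_of_continuousOn hGc
  obtain ⟨Cgf, hCgf⟩ := isCompact_Icc.exists_bound_of_continuousOn (hg₂.mul hf)
  have hk : IntegrableOn (fun s : ℝ => (τ - s) ^ (-(1 / 2 : ℝ))) (Ioo t₀ τ) :=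
    integrableOn_sub_rpow_Ioo (by norm_num)
  have hLi : IntegrableOn (fun s => (τ - s) ^ (-(1 / 2 : ℝ)) * g₂ s * f s) (Ioo t₀ τ) := by
    have h : IntegrableOn (fun s => (τ - s) ^ (-(1 / 2 : ℝ)) * (g₂ s * f s)) (Ioo t₀ τ) := by
      refine Integrable.mul_bdd (c := Cgf) hk ?_ ?_
      · exact ((hg₂.mul hf).mono Ioo_subset_Icc_self).aestronglyMeasurable measurableSet_Ioo
      · exact (ae_restrict_iff' measurableSet_Ioo).2
          (Eventually.of_forall fun s hs => hCgf s (Ioo_subset_Icc_self hs))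
    exact h.congr_fun (fun s _ => by ring) measurableSet_Ioo
  have hwi : IntegrableOn w (Ioo t₀ τ) :=
    (setIntegral_sub_rpow_neg_mul_rpow_neg_le (by norm_num) (by norm_num) hγ0 hγ1 ht₀ hτ0).1
  have hGm : AEStronglyMeasurable G (volume.restrict (Ioo t₀ τ)) :=
    (hGc.mono Ioo_subset_Icc_self).aestronglyMeasurable measurableSet_Ioo
  have hGbd : ∀ᵐ s ∂(volume.restrict (Ioo t₀ τ)), ‖G s‖ ≤ CG :=
    (ae_restrict_iff' measurableSet_Ioo).2
      (Eventually.of_forall fun s hs => hCG s (Ioo_subset_Icc_self hs))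
  have hwG : IntegrableOn (fun s => w s * G s) (Ioo t₀ τ) := Integrable.mul_bdd hwi hGm hGbd
  -- membership in `L^{p'}` and `L^{p}`
  have hwLp : MemLp w (ENNReal.ofReal p') (volume.restrict (Ioo t₀ τ)) := by
    refine (MeasureTheory.integrable_norm_rpow_iff hwm.aestronglyMeasurable
      (ENNReal.ofReal_pos.2 hp'0).ne' ENNReal.ofReal_ne_top).1 ?_
    refine hBi.congr_fun (fun s hs => ?_) measurableSet_Ioo
    rw [ENNReal.toReal_ofReal hp'0.le, Real.norm_of_nonneg (hw0 s hs), hwp' s hs]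
  have hGLp : MemLp G (ENNReal.ofReal p) (volume.restrict (Ioo t₀ τ)) :=
    MemLp.of_bound hGm CG hGbd
  -- Hölder
  have hholder := MeasureTheory.integral_mul_le_Lp_mul_Lq_of_nonneg hpp'
    ((ae_restrict_iff' measurableSet_Ioo).2 (Eventually.of_forall hw0))
    ((ae_restrict_iff' measurableSet_Ioo).2
      (Eventually.of_forall fun s hs => hG0 s (Ioo_subset_Icc_self hs))) hwLp hGLp
  -- the two factors
  have hwB : (∫ s in Ioo t₀ τ, w s ^ p') ^ (1 / p') ≤ B ^ (1 / p') := by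
    refine Real.rpow_le_rpow (setIntegral_nonneg measurableSet_Ioo fun s hs =>
      Real.rpow_nonneg (hw0 s hs) _) ?_ (by positivity)
    rw [setIntegral_congr_fun measurableSet_Ioo (fun s hs => hwp' s hs)]
    exact hB
  have hGp : ∫ s in Ioo t₀ τ, G s ^ p = ∫ s in t₀..τ, g₂ s ^ 2 * f s ^ p := by
    rw [intervalIntegral.integral_of_le hτ.le, integral_Ioc_eq_integral_Ioo]
    refine setIntegral_congr_fun measurableSet_Ioo fun s hs => ?_
    have hsI : s ∈ Icc t₀ τ := Ioo_subset_Icc_self hs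
    have hg := hg₂0 s hsI
    simp only [hG]
    rw [Real.mul_rpow (Real.rpow_nonneg hg _) (hf0 s hsI), ← Real.rpow_mul hg]
    have he : 2 / p * p = 2 := by field_simp
    rw [he, Real.rpow_two]
  have hI0 : 0 ≤ (∫ s in Ioo t₀ τ, G s ^ p) ^ (1 / p) :=
    Real.rpow_nonneg (setIntegral_nonneg measurableSet_Ioo fun s hs =>
      Real.rpow_nonneg (hG0 s (Ioo_subset_Icc_self hs)) _) _
  -- assemble
  calc ∫ s in t₀..τ, (τ - s) ^ (-(1 / 2 : ℝ)) * g₂ s * f s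
      = ∫ s in Ioo t₀ τ, (τ - s) ^ (-(1 / 2 : ℝ)) * g₂ s * f s := by
        rw [intervalIntegral.integral_of_le hτ.le, integral_Ioc_eq_integral_Ioo]
    _ ≤ ∫ s in Ioo t₀ τ, M ^ (1 - 2 / p) * (w s * G s) :=
        setIntegral_mono_on hLi (hwG.const_mul _) measurableSet_Ioo hpt
    _ = M ^ (1 - 2 / p) * ∫ s in Ioo t₀ τ, w s * G s := MeasureTheory.integral_const_mul _ _
    _ ≤ M ^ (1 - 2 / p) *
          ((∫ s in Ioo t₀ τ, w s ^ p') ^ (1 / p') * (∫ s in Ioo t₀ τ, G s ^ p) ^ (1 / p)) :=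
        mul_le_mul_of_nonneg_left hholder (Real.rpow_nonneg hM0 _)
    _ ≤ M ^ (1 - 2 / p) * (B ^ (1 / p') * (∫ s in Ioo t₀ τ, G s ^ p) ^ (1 / p)) := by
        gcongr
    _ = M ^ (1 - 2 / p) * B ^ (1 - 1 / p) * (∫ s in t₀..τ, g₂ s ^ 2 * f s ^ p) ^ (1 / p) := by
        rw [h1p', hGp]
        ring

/-- Interval integrability of `s ↦ (τ - s)^{-1/2} g(s) f(s)` on `[t₀, τ]` for `g, f` continuous
there (Abel kernel times a bounded function). [folklore] -/
theorem intervalIntegrable_abel_mul {t₀ τ : ℝ} {f g : ℝ → ℝ} (hτ : t₀ ≤ τ)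
    (hf : ContinuousOn f (Icc t₀ τ)) (hg : ContinuousOn g (Icc t₀ τ)) :
    IntervalIntegrable (fun s => (τ - s) ^ (-(1 / 2 : ℝ)) * g s * f s) volume t₀ τ := by
  obtain ⟨C, hC⟩ := isCompact_Icc.exists_bound_of_continuousOn (hg.mul hf)
  have hk : IntegrableOn (fun s : ℝ => (τ - s) ^ (-(1 / 2 : ℝ))) (Ioo t₀ τ) :=
    integrableOn_sub_rpow_Ioo (by norm_num)
  have h : IntegrableOn (fun s => (τ - s) ^ (-(1 / 2 : ℝ)) * (g s * f s)) (Ioo t₀ τ) := by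
    refine Integrable.mul_bdd (c := C) hk ?_ ?_
    · exact ((hg.mul hf).mono Ioo_subset_Icc_self).aestronglyMeasurable measurableSet_Ioo
    · exact (ae_restrict_iff' measurableSet_Ioo).2
        (Eventually.of_forall fun s hs => hC s (Ioo_subset_Icc_self hs))
  rw [intervalIntegrable_iff_integrableOn_Ioo_of_le hτ]
  exact h.congr_fun (fun s _ => by ring) measurableSet_Ioo

/-- **Lemma B.3 of Coiculescu–Palasek (the endpoint fractional Grönwall inequality).** For every
`p > 2` there is a constant `C = C(p) > 0` with the following property. Let `t₀ ≥ 0` and let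
`a`, `f`, `g₁`, `g₂` be non-negative functions on `[t₀, T]`, with `f, g₁, g₂` continuous and `a`
non-decreasing, such that
`f(t) ≤ a(t) + ∫_{t₀}^t (g₁(s) + (t-s)^{-1/2} g₂(s)) f(s) ds` for all `t ∈ [t₀, T]`. Then for every
`t ∈ [t₀, T]` and every `M` with `s^{1/2} g₂(s) ≤ M` on `[t₀, t]`,
`f(t) ≤ C a(t) exp(C (∫_{t₀}^t g₁(s) ds + M^{p-2} ∫_{t₀}^t g₂(s)² ds))` — in print
"`f(t) ≲_p a(t) exp(O_p(∫_{t₀}^t g₁ + ‖s^{1/2}g₂‖_{L^∞([t₀,t])}^{p-2} ∫_{t₀}^t g₂²))` for all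
`t ≥ t₀`" ("the extra factor `‖s^{1/2}g₂‖_{L^∞}` in the exponential reflects the failure of the
Hardy–Littlewood–Sobolev inequality at the `L^∞` endpoint"). Printed on `[t₀, ∞)` with
`a, f, gᵢ` positive continuous; here on a compact interval, with non-negativity, and the
continuity of `a` is not used. Proof as printed: Hölder (`integral_abel_mul_le_of_sqrt_mul_le`),
the Abel–Beta bound (`setIntegral_sub_rpow_neg_mul_rpow_neg_le`, `α + β = 1`), then Lemma B.2
(`nonlinear_gronwall_const`, coefficient frozen at `t`) with `C₆ = 4^p`; here
`C = 4^p max(1, B^{p-1})`, `B = 1/(1-α) + 1/(1-β)`.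
[cite: CoiculescuPalasek2025, App. B, Lemma B.3] -/
theorem fractional_gronwall {p : ℝ} (hp : 2 < p) :
    ∃ C : ℝ, 0 < C ∧ ∀ ⦃t₀ T : ℝ⦄ ⦃f a g₁ g₂ : ℝ → ℝ⦄, 0 ≤ t₀ →
      ContinuousOn f (Icc t₀ T) → ContinuousOn g₁ (Icc t₀ T) → ContinuousOn g₂ (Icc t₀ T) →
      (∀ t ∈ Icc t₀ T, 0 ≤ f t) → (∀ t ∈ Icc t₀ T, 0 ≤ g₁ t) → (∀ t ∈ Icc t₀ T, 0 ≤ g₂ t) →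
      (∀ t ∈ Icc t₀ T, 0 ≤ a t) → MonotoneOn a (Icc t₀ T) →
      (∀ t ∈ Icc t₀ T,
        f t ≤ a t + ∫ s in t₀..t, (g₁ s + (t - s) ^ (-(1 / 2 : ℝ)) * g₂ s) * f s) →
      ∀ ⦃t : ℝ⦄, t ∈ Icc t₀ T → ∀ ⦃M : ℝ⦄, (∀ s ∈ Icc t₀ t, Real.sqrt s * g₂ s ≤ M) →
        f t ≤ C * a t *
          Real.exp (C * ((∫ s in t₀..t, g₁ s) + M ^ (p - 2) * ∫ s in t₀..t, g₂ s ^ 2)) := by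
  -- exponents and constants
  have hp0 : 0 < p := by linarith
  have hp1 : 1 < p := by linarith
  have hp1' : (0 : ℝ) < p - 1 := by linarith
  have h2p1 : (0 : ℝ) < 2 * (p - 1) := by linarith
  set α : ℝ := p / (2 * (p - 1)) with hα
  set β : ℝ := (p - 2) / (2 * (p - 1)) with hβ
  have hα0 : 0 ≤ α := by positivity
  have hα1 : α < 1 := by
    rw [hα, div_lt_one h2p1]
    linarith
  have hβ0 : 0 ≤ β := by
    rw [hβ]
    exact div_nonneg (by linarith) h2p1.le
  have hβ1 : β < 1 := by
    rw [hβ, div_lt_one h2p1]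
    linarith
  have hαβ : 1 - α - β = 0 := by
    rw [hα, hβ]
    field_simp
    ring
  set B : ℝ := 1 / (1 - α) + 1 / (1 - β) with hBdef
  have hB0 : 0 < B := by
    have h1 : 0 < 1 / (1 - α) := by
      apply div_pos one_pos
      linarith
    have h2 : 0 < 1 / (1 - β) := by
      apply div_pos one_pos
      linarith
    exact add_pos h1 h2
  set C₆ : ℝ := 4 ^ p with hC₆def
  have hC₆ : 0 < C₆ := by positivity
  have hC : C₆⁻¹ + (C₆ * p) ^ (-p⁻¹) < 1 := by
    have h4 : (4 : ℝ) ≤ C₆ := by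
      have h := Real.rpow_le_rpow_of_exponent_le (show (1 : ℝ) ≤ 4 by norm_num) hp1.le
      rwa [Real.rpow_one] at h
    have h1 : C₆⁻¹ ≤ 4⁻¹ := by
      rw [inv_le_inv₀ hC₆ four_pos]
      exact h4
    have h2 : (C₆ * p) ^ (-p⁻¹) ≤ 4⁻¹ := by
      rw [Real.mul_rpow hC₆.le hp0.le, hC₆def, ← Real.rpow_mul (by norm_num : (0 : ℝ) ≤ 4),
        mul_neg, mul_inv_cancel₀ hp0.ne', Real.rpow_neg_one]
      have h3 : p ^ (-p⁻¹) ≤ 1 :=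
        Real.rpow_le_one_of_one_le_of_nonpos hp1.le (by
          rw [neg_nonpos]; exact inv_nonneg.2 hp0.le)
      have h4' : (0 : ℝ) ≤ 4⁻¹ := by norm_num
      calc (4 : ℝ)⁻¹ * p ^ (-p⁻¹) ≤ 4⁻¹ * 1 := mul_le_mul_of_nonneg_left h3 h4'
        _ = 4⁻¹ := mul_one _
    have : (4 : ℝ)⁻¹ + 4⁻¹ < 1 := by norm_num
    linarith
  set C : ℝ := C₆ * max 1 (B ^ (p - 1)) with hCdef
  have hmax1 : 1 ≤ max 1 (B ^ (p - 1)) := le_max_left _ _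
  have hC₆C : C₆ ≤ C := by
    rw [hCdef]
    nlinarith
  refine ⟨C, by positivity, ?_⟩
  intro t₀ T f a g₁ g₂ ht₀ hf hg₁ hg₂ hf0 hg₁0 hg₂0 ha0 ha hineq t ht M hM
  have hsub : Icc t₀ t ⊆ Icc t₀ T := Icc_subset_Icc_right ht.2
  have ht₀I : t₀ ∈ Icc t₀ t := left_mem_Icc.2 ht.1
  have hM0 : 0 ≤ M :=
    (mul_nonneg (Real.sqrt_nonneg _) (hg₂0 t₀ (hsub ht₀I))).trans (hM t₀ ht₀I)
  -- the frozen nonlinear coefficient `K = L^p = M^{p-2} B^{p-1}`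
  set L : ℝ := M ^ (1 - 2 / p) * B ^ (1 - 1 / p) with hLdef
  have hL0 : 0 ≤ L := mul_nonneg (Real.rpow_nonneg hM0 _) (Real.rpow_nonneg hB0.le _)
  set K : ℝ := L ^ p with hKdef
  have hK0 : 0 ≤ K := Real.rpow_nonneg hL0 _
  have hKeq : K = M ^ (p - 2) * B ^ (p - 1) := by
    rw [hKdef, hLdef, Real.mul_rpow (Real.rpow_nonneg hM0 _) (Real.rpow_nonneg hB0.le _),
      ← Real.rpow_mul hM0, ← Real.rpow_mul hB0.le]
    have e1 : (1 - 2 / p) * p = p - 2 := by field_simp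
    have e2 : (1 - 1 / p) * p = p - 1 := by field_simp
    rw [e1, e2]
  -- Lemma B.2 (constant coefficients) on `[t₀, t]` with `h₁ = g₁`, `h₂ = K g₂²`, `a = a(t)`
  have hft : ContinuousOn f (Icc t₀ t) := hf.mono hsub
  have hg₁t : ContinuousOn g₁ (Icc t₀ t) := hg₁.mono hsub
  have hg₂t : ContinuousOn g₂ (Icc t₀ t) := hg₂.mono hsub
  have hh₂t : ContinuousOn (fun s => K * g₂ s ^ 2) (Icc t₀ t) := (hg₂t.pow 2).const_smul K
  have key := nonlinear_gronwall_const (t₀ := t₀) (T := t) (a := a t) (f := f) (h₁ := g₁)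
    (h₂ := fun s => K * g₂ s ^ 2) hp1 hC₆ hC (ha0 t ht) hft hg₁t hh₂t
    (fun s hs => hf0 s (hsub hs)) (fun s hs => hg₁0 s (hsub hs))
    (fun s hs => mul_nonneg hK0 (sq_nonneg _)) ?_ t ⟨ht.1, le_rfl⟩
  · -- from `key` to the claim
    have hu : uIcc t₀ t = Icc t₀ t := uIcc_of_le ht.1
    have hi₁ : IntervalIntegrable g₁ volume t₀ t :=
      ContinuousOn.intervalIntegrable (by rw [hu]; exact hg₁t)
    have hi₂ : IntervalIntegrable (fun s => g₂ s ^ 2) volume t₀ t :=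
      ContinuousOn.intervalIntegrable (by rw [hu]; exact hg₂t.pow 2)
    have he : ∫ s in t₀..t, (g₁ s + K * g₂ s ^ 2) =
        (∫ s in t₀..t, g₁ s) + K * ∫ s in t₀..t, g₂ s ^ 2 := by
      rw [intervalIntegral.integral_add hi₁ (hi₂.const_mul K),
        intervalIntegral.integral_const_mul]
    rw [he] at key
    have hX₁ : 0 ≤ ∫ s in t₀..t, g₁ s :=
      intervalIntegral.integral_nonneg ht.1 fun s hs => hg₁0 s (hsub hs)
    have hX₂ : 0 ≤ ∫ s in t₀..t, g₂ s ^ 2 :=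
      intervalIntegral.integral_nonneg ht.1 fun s _ => sq_nonneg _
    have hMp : 0 ≤ M ^ (p - 2) := Real.rpow_nonneg hM0 _
    have hexp : C₆ * ((∫ s in t₀..t, g₁ s) + K * ∫ s in t₀..t, g₂ s ^ 2) ≤
        C * ((∫ s in t₀..t, g₁ s) + M ^ (p - 2) * ∫ s in t₀..t, g₂ s ^ 2) := by
      have h1 : C₆ * K ≤ C * M ^ (p - 2) := by
        rw [hKeq, hCdef]
        have h2 : B ^ (p - 1) ≤ max 1 (B ^ (p - 1)) := le_max_right _ _
        calc C₆ * (M ^ (p - 2) * B ^ (p - 1)) = C₆ * B ^ (p - 1) * M ^ (p - 2) := by ring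
          _ ≤ C₆ * max 1 (B ^ (p - 1)) * M ^ (p - 2) := by gcongr
      calc C₆ * ((∫ s in t₀..t, g₁ s) + K * ∫ s in t₀..t, g₂ s ^ 2)
          = C₆ * (∫ s in t₀..t, g₁ s) + C₆ * K * ∫ s in t₀..t, g₂ s ^ 2 := by ring
        _ ≤ C * (∫ s in t₀..t, g₁ s) + C * M ^ (p - 2) * ∫ s in t₀..t, g₂ s ^ 2 := by
            gcongr
        _ = C * ((∫ s in t₀..t, g₁ s) + M ^ (p - 2) * ∫ s in t₀..t, g₂ s ^ 2) := by ring
    have hat : 0 ≤ a t := ha0 t ht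
    calc f t ≤ C₆ * a t * Real.exp (C₆ * ((∫ s in t₀..t, g₁ s) + K * ∫ s in t₀..t, g₂ s ^ 2)) :=
          key
      _ ≤ C * a t *
          Real.exp (C * ((∫ s in t₀..t, g₁ s) + M ^ (p - 2) * ∫ s in t₀..t, g₂ s ^ 2)) := by
          gcongr
  · -- the hypothesis of Lemma B.2 on `[t₀, t]`: Hölder and the Abel–Beta bound
    intro τ hτ
    have hτT : τ ∈ Icc t₀ T := hsub hτ
    rcases eq_or_lt_of_le hτ.1 with heq | hlt
    · -- `τ = t₀`: all integrals vanish
      subst heq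
      have h := hineq t₀ hτT
      simp only [intervalIntegral.integral_same, add_zero] at h
      simp only [intervalIntegral.integral_same, add_zero,
        Real.zero_rpow (inv_ne_zero hp0.ne')]
      exact h.trans (ha hτT ht hτ.2)
    · have hτ0 : 0 < τ := lt_of_le_of_lt ht₀ hlt
      have hsubτ : Icc t₀ τ ⊆ Icc t₀ t := Icc_subset_Icc_right hτ.2
      have hfτ : ContinuousOn f (Icc t₀ τ) := hft.mono hsubτ
      have hg₁τ : ContinuousOn g₁ (Icc t₀ τ) := hg₁t.mono hsubτ
      have hg₂τ : ContinuousOn g₂ (Icc t₀ τ) := hg₂t.mono hsubτ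
      -- the Abel–Beta bound at `τ`
      obtain ⟨hBi, hBle⟩ := setIntegral_sub_rpow_neg_mul_rpow_neg_le (t₀ := t₀) hα0 hα1 hβ0 hβ1
        ht₀ hτ0
      have hB : ∫ s in Ioo t₀ τ, (τ - s) ^ (-α) * s ^ (-β) ≤ B := by
        refine hBle.trans (le_of_eq ?_)
        rw [hαβ, Real.rpow_zero, mul_one]
      -- Hölder
      have hJ := integral_abel_mul_le_of_sqrt_mul_le (B := B) hp ht₀ hlt hfτ hg₂τ
        (fun s hs => hf0 s (hsub (hsubτ hs))) (fun s hs => hg₂0 s (hsub (hsubτ hs)))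
        (fun s hs => hM s (hsubτ hs)) hBi hB
      -- `L (∫ g₂² f^p)^{1/p} = (∫ K g₂² f^p)^{1/p}`
      have hI0 : 0 ≤ ∫ s in t₀..τ, g₂ s ^ 2 * f s ^ p :=
        intervalIntegral.integral_nonneg hτ.1 fun s hs =>
          mul_nonneg (sq_nonneg _) (Real.rpow_nonneg (hf0 s (hsub (hsubτ hs))) _)
      have hLI : L * (∫ s in t₀..τ, g₂ s ^ 2 * f s ^ p) ^ (1 / p) =
          (∫ s in t₀..τ, K * g₂ s ^ 2 * f s ^ p) ^ p⁻¹ := by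
        have he : ∫ s in t₀..τ, K * g₂ s ^ 2 * f s ^ p =
            K * ∫ s in t₀..τ, g₂ s ^ 2 * f s ^ p := by
          rw [← intervalIntegral.integral_const_mul]
          congr 1
          ext s
          ring
        rw [he, hKdef, Real.mul_rpow (Real.rpow_nonneg hL0 _) hI0,
          Real.rpow_rpow_inv hL0 hp0.ne', one_div]
      -- split the hypothesis at `τ`
      have hi₁ : IntervalIntegrable (fun s => g₁ s * f s) volume t₀ τ :=
        ContinuousOn.intervalIntegrable (by rw [uIcc_of_le hτ.1]; exact hg₁τ.mul hfτ)
      have hi₂ : IntervalIntegrable (fun s => (τ - s) ^ (-(1 / 2 : ℝ)) * g₂ s * f s) volume t₀ τ :=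
        intervalIntegrable_abel_mul hτ.1 hfτ hg₂τ
      have hsplit : ∫ s in t₀..τ, (g₁ s + (τ - s) ^ (-(1 / 2 : ℝ)) * g₂ s) * f s =
          (∫ s in t₀..τ, g₁ s * f s) + ∫ s in t₀..τ, (τ - s) ^ (-(1 / 2 : ℝ)) * g₂ s * f s := by
        rw [← intervalIntegral.integral_add hi₁ hi₂]
        congr 1
        ext s
        ring
      calc f τ ≤ a τ + ∫ s in t₀..τ, (g₁ s + (τ - s) ^ (-(1 / 2 : ℝ)) * g₂ s) * f s := hineq τ hτT
        _ = a τ + (∫ s in t₀..τ, g₁ s * f s) +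
              ∫ s in t₀..τ, (τ - s) ^ (-(1 / 2 : ℝ)) * g₂ s * f s := by rw [hsplit, add_assoc]
        _ ≤ a t + (∫ s in t₀..τ, g₁ s * f s) +
              L * (∫ s in t₀..τ, g₂ s ^ 2 * f s ^ p) ^ (1 / p) := by
            gcongr
            · exact ha hτT ht hτ.2
        _ = a t + (∫ s in t₀..τ, g₁ s * f s) + (∫ s in t₀..τ, K * g₂ s ^ 2 * f s ^ p) ^ p⁻¹ := by
            rw [hLI]

/-- **Lemma B.3 with `p = 3`**, the case invoked in the proof of Prop. 4.2 of Coiculescu–Palasek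
("apply Lemma B.3 with `p = 3` (say), `g₁(s) = s^{-1/2}‖v(s)‖_{L^∞}` and `g₂(s) = ‖v(s)‖_{L^∞}`,
which lead to `h(t) ≲ (t')^{-1+α}‖a‖_Y exp(O(‖v‖_{L¹([t',t],t^{-1/2}dt;L^∞)} +
‖s^{1/2}v‖_{L^∞_{t,x}([t',t])} ‖v‖²_{L²([t',t];L^∞)}))`"): the exponent is linear in the bound `M`
for `s^{1/2} g₂(s)`. [cite: CoiculescuPalasek2025, App. B, Lemma B.3 and proof of Prop. 4.2] -/
theorem fractional_gronwall_three :
    ∃ C : ℝ, 0 < C ∧ ∀ ⦃t₀ T : ℝ⦄ ⦃f a g₁ g₂ : ℝ → ℝ⦄, 0 ≤ t₀ →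
      ContinuousOn f (Icc t₀ T) → ContinuousOn g₁ (Icc t₀ T) → ContinuousOn g₂ (Icc t₀ T) →
      (∀ t ∈ Icc t₀ T, 0 ≤ f t) → (∀ t ∈ Icc t₀ T, 0 ≤ g₁ t) → (∀ t ∈ Icc t₀ T, 0 ≤ g₂ t) →
      (∀ t ∈ Icc t₀ T, 0 ≤ a t) → MonotoneOn a (Icc t₀ T) →
      (∀ t ∈ Icc t₀ T,
        f t ≤ a t + ∫ s in t₀..t, (g₁ s + (t - s) ^ (-(1 / 2 : ℝ)) * g₂ s) * f s) →
      ∀ ⦃t : ℝ⦄, t ∈ Icc t₀ T → ∀ ⦃M : ℝ⦄, (∀ s ∈ Icc t₀ t, Real.sqrt s * g₂ s ≤ M) →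
        f t ≤ C * a t *
          Real.exp (C * ((∫ s in t₀..t, g₁ s) + M * ∫ s in t₀..t, g₂ s ^ 2)) := by
  obtain ⟨C, hC, h⟩ := fractional_gronwall (p := 3) (by norm_num)
  refine ⟨C, hC, ?_⟩
  intro t₀ T f a g₁ g₂ ht₀ hf hg₁ hg₂ hf0 hg₁0 hg₂0 ha0 ha hineq t ht M hM
  have h' := h ht₀ hf hg₁ hg₂ hf0 hg₁0 hg₂0 ha0 ha hineq ht hM
  have he : (3 : ℝ) - 2 = 1 := by norm_num
  rwa [he, Real.rpow_one] at h'

end Literature.Analysis.ODE
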